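import Summits.ValiantsHypothesis.ValiantsHypothesis.Theorems.LacunarySymmetroidMatrixDescartesCensusPencilPlaneLaw

/-!
# The skeleton value `m(K−1)` is the commuting optimum at EVERY span rank

Line `span-rank` of crux `MatrixDescartes` (stmt-18050).  A `K`-letter `m × m` pencil whose letters are DIAGONAL
(equivalently, by `posRootCount_congr`, simultaneously diagonalisable by one congruence `S ↦ P S Pᵀ`, `det P ≠ 0`)
has at most `m(K−1)` distinct positive determinant roots, whatever its span rank: `det = ∏_j k_j` with `k_j` the
`K`-nomial of the `j`-th diagonal entries, and Descartes bounds each factor.  With `spanRootLawAt_two_iff`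
(p589587/p590094: span rank `≤ 2` ⇒ `≤ m(K−1)`, attained) this pins the dictionary of the line: every positive root
beyond `m(K−1)` is paid for by NON-COMMUTATIVITY of a span of rank `≥ 3`.  0 sorry; nothing on B / `MatrixDescartes`.
-/

set_option linter.dupNamespace false
set_option linter.unusedVariables false
set_option linter.unusedSectionVars false

namespace Summit.ValiantsHypothesis.ValiantsHypothesis.Theorems.LacunarySymmetroidMatrixDescartes.Census.SpanRank

open Polynomial Matrix Finset
open scoped BigOperators
open Summit.ValiantsHypothesis.ValiantsHypothesis.Theorems.LacunarySymmetroidMatrixDescartes.Census.SignSplit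
  (pencil posRootCount)

section Diagonal

variable {K m : ℕ} (d : Fin K → ℕ) (w : Fin K → Fin m → ℝ)

/-- Evaluation of the determinant of a general pencil (the tree's `eval_det_pencil`, restated for `pencil`). -/
theorem eval_det_pencil' (S : Fin K → Matrix (Fin m) (Fin m) ℝ) (s : ℝ) :
    ((pencil d S).det).eval s = Matrix.det (∑ l, s ^ d l • S l) := by
  unfold pencil
  have h := RingHom.map_det (Polynomial.evalRingHom s) (∑ l, (X : ℝ[X]) ^ d l • (S l).map C)
  rw [Polynomial.coe_evalRingHom] at h
  rw [h]
  congr 1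
  ext i j
  simp only [RingHom.mapMatrix_apply, Matrix.map_apply, Matrix.sum_apply, Matrix.smul_apply, smul_eq_mul,
    Polynomial.coe_evalRingHom, eval_finsetSum, eval_mul, eval_pow, eval_X, eval_C]

/-- A diagonal pencil evaluates to the diagonal matrix of its entry `K`-nomials. -/
theorem sum_smul_diagonal (s : ℝ) :
    (∑ l, s ^ d l • Matrix.diagonal (w l)) = Matrix.diagonal fun j => (knom d fun l => w l j).eval s := by
  ext i j
  simp only [Matrix.sum_apply, Matrix.smul_apply, Matrix.diagonal_apply, smul_eq_mul, eval_knom]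
  split_ifs with h
  · simp [mul_comm]
  · simp

/-- `det` of a diagonal pencil at `s` is the product of the entry `K`-nomials at `s`. -/
theorem eval_det_pencil_diagonal (s : ℝ) :
    ((pencil d fun l => Matrix.diagonal (w l)).det).eval s = ∏ j, (knom d fun l => w l j).eval s := by
  rw [eval_det_pencil', sum_smul_diagonal, Matrix.det_diagonal]

/-- Hence `det` of a diagonal pencil IS the product of the entry `K`-nomials. -/
theorem det_pencil_diagonal :
    (pencil d fun l => Matrix.diagonal (w l)).det = ∏ j, knom d fun l => w l j := by
  apply Polynomial.funext
  intro s
  rw [eval_det_pencil_diagonal, eval_prod]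

/-- **Diagonal (commuting) pencils obey the skeleton bound at every span rank**: at most `m(K−1)` distinct positive
roots. [this file; Descartes per factor = `card_posRoots_knom_le`] -/
theorem posRootCount_diagonal_le : posRootCount d (fun l => Matrix.diagonal (w l)) ≤ m * (K - 1) := by
  classical
  unfold posRootCount
  rw [det_pencil_diagonal]
  rcases Nat.eq_zero_or_pos K with hK | hK
  · -- no letters: every factor is `0`; if `m = 0` the product is `1` (no roots), else it is `0` (no roots either)
    subst hK
    have hk : ∀ j : Fin m, (knom d fun l => w l j) = 0 := fun j => by simp [knom]
    rcases Nat.eq_zero_or_pos m with hm | hm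
    · subst hm
      simp
    · have : (∏ j : Fin m, knom d fun l => w l j) = 0 :=
        Finset.prod_eq_zero (Finset.mem_univ (⟨0, hm⟩ : Fin m)) (hk _)
      rw [this]
      simp
  by_cases hz : (∏ j : Fin m, knom d fun l => w l j) = 0
  · rw [hz]; simp
  have hne : ∀ j : Fin m, (knom d fun l => w l j) ≠ 0 := fun j h =>
    hz (Finset.prod_eq_zero (Finset.mem_univ j) h)
  -- positive roots of the product lie in the union of the positive roots of the factors
  have hsub : ((∏ j : Fin m, knom d fun l => w l j).roots.toFinset.filter fun t => 0 < t) ⊆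
      Finset.univ.biUnion fun j : Fin m => ((knom d fun l => w l j).roots.toFinset.filter fun t => 0 < t) := by
    intro t ht
    rw [Finset.mem_filter, Multiset.mem_toFinset, mem_roots hz, IsRoot.def, eval_prod,
      Finset.prod_eq_zero_iff] at ht
    obtain ⟨⟨j, _, hj⟩, htpos⟩ := ht
    rw [Finset.mem_biUnion]
    refine ⟨j, Finset.mem_univ j, ?_⟩
    rw [Finset.mem_filter, Multiset.mem_toFinset, mem_roots (hne j)]
    exact ⟨hj, htpos⟩
  calc ((∏ j : Fin m, knom d fun l => w l j).roots.toFinset.filter fun t => 0 < t).card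
      ≤ (Finset.univ.biUnion fun j : Fin m =>
          ((knom d fun l => w l j).roots.toFinset.filter fun t => 0 < t)).card := Finset.card_le_card hsub
    _ ≤ ∑ j : Fin m, ((knom d fun l => w l j).roots.toFinset.filter fun t => 0 < t).card :=
          Finset.card_biUnion_le
    _ ≤ ∑ _j : Fin m, (K - 1) := Finset.sum_le_sum fun j _ => card_posRoots_knom_le hK d _
    _ = m * (K - 1) := by simp

end Diagonal

/-! ## Congruence invariance of the census count -/

section Congruence

variable {K m : ℕ} (d : Fin K → ℕ) (S : Fin K → Matrix (Fin m) (Fin m) ℝ) (P Q : Matrix (Fin m) (Fin m) ℝ)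

/-- `pencil` of the two-sided transformed letters. -/
theorem pencil_conj : pencil d (fun l => P * S l * Q) = P.map C * pencil d S * Q.map C := by
  unfold pencil
  rw [Finset.mul_sum, Finset.sum_mul]
  refine Finset.sum_congr rfl fun l _ => ?_
  rw [Matrix.map_mul, Matrix.map_mul, Matrix.mul_smul, Matrix.smul_mul]

/-- The determinant picks up the constant factor `det P · det Q`. -/
theorem det_pencil_conj :
    (pencil d (fun l => P * S l * Q)).det = C (P.det * Q.det) * (pencil d S).det := by
  rw [pencil_conj, Matrix.det_mul, Matrix.det_mul]
  have hP : (P.map C).det = C P.det := by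
    rw [show P.map C = (Polynomial.C : ℝ →+* ℝ[X]).mapMatrix P from rfl, ← RingHom.map_det]
  have hQ : (Q.map C).det = C Q.det := by
    rw [show Q.map C = (Polynomial.C : ℝ →+* ℝ[X]).mapMatrix Q from rfl, ← RingHom.map_det]
  rw [hP, hQ, map_mul]
  ring

/-- **Congruence / equivalence invariance**: `S ↦ P S Q` with `det P, det Q ≠ 0` does not change the census count.
[this file] -/
theorem posRootCount_conj (hP : P.det ≠ 0) (hQ : Q.det ≠ 0) :
    posRootCount d (fun l => P * S l * Q) = posRootCount d S := by
  unfold posRootCount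
  rw [det_pencil_conj, Polynomial.roots_C_mul _ (mul_ne_zero hP hQ)]

/-- In particular for a congruence `S ↦ P S Pᵀ`. -/
theorem posRootCount_congr (hP : P.det ≠ 0) :
    posRootCount d (fun l => P * S l * Pᵀ) = posRootCount d S :=
  posRootCount_conj d S P Pᵀ hP (by rwa [Matrix.det_transpose])

/-- **Simultaneously congruence-diagonalisable pencils obey the skeleton bound** `m(K−1)` (any span rank).
[this file] -/
theorem posRootCount_le_of_congr_diagonal (hP : P.det ≠ 0) (w : Fin K → Fin m → ℝ)
    (hS : ∀ l, S l = P * Matrix.diagonal (w l) * Pᵀ) : posRootCount d S ≤ m * (K - 1) := by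
  have : S = fun l => P * Matrix.diagonal (w l) * Pᵀ := funext hS
  rw [this, posRootCount_congr d _ P hP]
  exact posRootCount_diagonal_le d w

end Congruence

end Summit.ValiantsHypothesis.ValiantsHypothesis.Theorems.LacunarySymmetroidMatrixDescartes.Census.SpanRank
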